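import Summits.PneNP.PneNP.Theorems.NegLimitedMonotoneClosureW
import Literature.Computability.Complexity.HarnikRazApproximators

/-!
# Route NegLimited — the CKR approximation scheme w.r.t. an arbitrary negative distribution (rung F-N1/p3, line r7-crosscut, file C3, generic half)

The approximators of Cavalar–Kumar–Rossman (§2.6; tree: `HarnikRazApproximators.lean`, §Scheme)
for the closure operator `closureW μ` of `NegLimitedMonotoneClosureW.lean`: `𝒜 = {trim(𝒯)}` over the
`μ`-closed up-sets, `f ⊔ g = trim(cl_μ(f ∨ g))`, `f ⊓ g = trim(cl_μ(f ∧ g))`, inputs `x_i ↦ {A : i ∈ A}`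
(closed as soon as `Pr_μ[i ∈ U] ≤ 1 - ε`), packaged as an `ApproxScheme` (`schemeW`), and the
NEGATIVE per-gate error bounds for the test family "all supports `U`, weight `μ U`": an approximate
gate gains at most `ε · #{A : |A| ≤ c}` (CKR Lemma 2.10 w.r.t. `μ`: `sum_gainedSupW_le`,
`sum_gainedInfW_le`). The positive side (perfect matchings; few MATCHING minterms via the biased
Matching Sunflower Lemma) is in `NegLimitedGapPMMinterms.lean`. Cell record:
HOME/pnp-ideate-p3/ROUND-7.md §4; part of the registered stub `stub_gapPMExp` of item stmt-PneNP-19861.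
-/

set_option linter.dupNamespace false -- `Summit.PneNP.PneNP.…`: summit = sub-problem name (D-0017 single-conjunct layout)

namespace Summit.PneNP.PneNP.Theorems.NegLimitedGapPM

open Finset Literature.Computability.Complexity Literature.Computability.Complexity.Razborov
  Literature.Computability.Complexity.CKR
open Literature.Combinatorics.SetFamily (finsetEquivFun)

variable {V : Type*} [Fintype V] [DecidableEq V] {μ : Finset V → ℝ} {c : ℕ} {ε : ℝ}

/-- **The approximation scheme of CKR w.r.t. `μ`**: approximators `IsApproxW μ c ε`, semantics "the
support of the input lies in the up-set", `f ⊔ g = trim(cl_μ(f ∨ g))`, `f ⊓ g = trim(cl_μ(f ∧ g))`,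
inputs `x_i ↦ containing i` (closed when `Pr_μ[i ∈ U] ≤ 1 - ε`, trimmed for `c ≥ 2`). -/
noncomputable def schemeW (μ : Finset V → ℝ) (c : ℕ) (ε : ℝ) (hμ : ∀ U, 0 ≤ μ U) (hc : 2 ≤ c)
    (hinp : ∀ i : V, prW μ (fun U : Finset V => i ∈ U) ≤ 1 - ε) :
    ApproxScheme V (Finset (Finset V)) where
  ok := IsApproxW μ c ε
  val 𝒜 x := decide (finsetEquivFun.symm x ∈ 𝒜)
  sup 𝒜 ℬ := trim c (closureW μ c ε (𝒜 ∪ ℬ))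
  inf 𝒜 ℬ := trim c (closureW μ c ε (𝒜 ∩ ℬ))
  inp i := containing i
  ok_inp i := ⟨containing i, isUpperSet_containing i, isClosedFamW_containing c (hinp i),
    (trim_containing hc i).symm⟩
  ok_sup 𝒜 ℬ _ _ := isApproxW_trim_closureW hμ _
  ok_inf 𝒜 ℬ _ _ := isApproxW_trim_closureW hμ _
  val_inp i x := by simp

/-- The semantics of the scheme on an input given by its support. -/
@[simp] theorem schemeW_val_finsetEquivFun (hμ : ∀ U, 0 ≤ μ U) (hc : 2 ≤ c)
    (hinp : ∀ i : V, prW μ (fun U : Finset V => i ∈ U) ≤ 1 - ε) (𝒜 : Finset (Finset V))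
    (U : Finset V) : (schemeW μ c ε hμ hc hinp).val 𝒜 (finsetEquivFun U) = decide (U ∈ 𝒜) := by
  simp [schemeW]

/-! ### Errors on the negative test inputs (CKR Lemma 2.10 per gate, w.r.t. `μ`) -/

/-- **An approximate OR gains little negative weight**: the supports rejected by `𝒜 ∨ ℬ` but accepted
by `𝒜 ⊔ ℬ = trim(cl_μ(𝒜 ∪ ℬ))` have `μ`-mass `≤ ε · #{A : |A| ≤ c}` (negative test family = all
supports `U`, input `finsetEquivFun U`, weight `μ U`). -/
theorem sum_gainedSupW_le (hμ : ∀ U, 0 ≤ μ U) (hμ1 : ∑ U, μ U = 1) (hc : 2 ≤ c)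
    (hinp : ∀ i : V, prW μ (fun U : Finset V => i ∈ U) ≤ 1 - ε) (hε0 : 0 ≤ ε)
    {𝒜 ℬ : Finset (Finset V)} (h𝒜 : IsApproxW μ c ε 𝒜) (hℬ : IsApproxW μ c ε ℬ) :
    ∑ U ∈ (schemeW μ c ε hμ hc hinp).gainedSup univ finsetEquivFun 𝒜 ℬ, μ U
      ≤ ε * #(univ.filter fun A : Finset V => #A ≤ c) := by
  have hup : IsUpperSet ((𝒜 ∪ ℬ : Finset (Finset V)) : Set (Finset V)) := by
    rw [coe_union]; exact h𝒜.isUpperSet.union hℬ.isUpperSet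
  refine le_trans ?_ (prW_not_mem_and_mem_closureW_le hμ hμ1 hε0 (𝒜 ∪ ℬ) hup)
  unfold prW
  refine sum_le_sum_of_subset_of_nonneg (fun U hU => ?_) fun U _ _ => hμ U
  rw [ApproxScheme.gainedSup, mem_filter] at hU
  obtain ⟨-, hU⟩ := hU
  simp only [schemeW_val_finsetEquivFun, Bool.or_eq_false_iff, decide_eq_false_iff_not,
    decide_eq_true_eq] at hU
  obtain ⟨⟨h1, h2⟩, h3⟩ := hU
  refine mem_filter.2 ⟨mem_univ _, fun h => ?_, trim_subset (isUpperSet_closureW _) h3⟩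
  rcases mem_union.1 h with h | h
  · exact h1 h
  · exact h2 h

/-- **An approximate AND gains little negative weight** (CKR Lemma 2.10 w.r.t. `μ`). -/
theorem sum_gainedInfW_le (hμ : ∀ U, 0 ≤ μ U) (hμ1 : ∑ U, μ U = 1) (hc : 2 ≤ c)
    (hinp : ∀ i : V, prW μ (fun U : Finset V => i ∈ U) ≤ 1 - ε) (hε0 : 0 ≤ ε)
    {𝒜 ℬ : Finset (Finset V)} (h𝒜 : IsApproxW μ c ε 𝒜) (hℬ : IsApproxW μ c ε ℬ) :
    ∑ U ∈ (schemeW μ c ε hμ hc hinp).gainedInf univ finsetEquivFun 𝒜 ℬ, μ U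
      ≤ ε * #(univ.filter fun A : Finset V => #A ≤ c) := by
  have hup : IsUpperSet ((𝒜 ∩ ℬ : Finset (Finset V)) : Set (Finset V)) := by
    rw [coe_inter]; exact h𝒜.isUpperSet.inter hℬ.isUpperSet
  refine le_trans ?_ (prW_not_mem_and_mem_closureW_le hμ hμ1 hε0 (𝒜 ∩ ℬ) hup)
  unfold prW
  refine sum_le_sum_of_subset_of_nonneg (fun U hU => ?_) fun U _ _ => hμ U
  rw [ApproxScheme.gainedInf, mem_filter] at hU
  obtain ⟨-, hU⟩ := hU
  simp only [schemeW_val_finsetEquivFun, Bool.and_eq_false_iff, decide_eq_false_iff_not,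
    decide_eq_true_eq] at hU
  obtain ⟨h12, h3⟩ := hU
  refine mem_filter.2 ⟨mem_univ _, fun h => ?_, trim_subset (isUpperSet_closureW _) h3⟩
  rcases h12 with h' | h'
  · exact h' (mem_inter.1 h).1
  · exact h' (mem_inter.1 h).2

/-- **The approximation method run with `schemeW`** (bookkeeping form of
`ApproxScheme.exists_approx_circuit` for this scheme): given per-gate POSITIVE error bounds `δP` for a
weighted positive test family `(P, ptP, wP)`, every monotone circuit `C` has an approximator `𝒜` and
exceptional sets with `wP(BadP) ≤ size · δP`, `μ(BadN) ≤ size · ε · #{A : |A| ≤ c}` such that off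
them `C = 1 ⇒ U ∈ 𝒜` on positive and `U ∈ 𝒜 ⇒ C(U) = 1` on negative test inputs. -/
theorem exists_approxW {σ : Type*} [DecidableEq σ] (hμ : ∀ U, 0 ≤ μ U) (hμ1 : ∑ U, μ U = 1)
    (hc : 2 ≤ c) (hinp : ∀ i : V, prW μ (fun U : Finset V => i ∈ U) ≤ 1 - ε) (hε0 : 0 ≤ ε)
    (P : Finset σ) (ptP : σ → V → Bool) (wP : σ → ℝ) (hwP : ∀ s, 0 ≤ wP s) (δP : ℝ)
    (hsupP : ∀ 𝒜 ℬ, IsApproxW μ c ε 𝒜 → IsApproxW μ c ε ℬ →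
      ∑ s ∈ (schemeW μ c ε hμ hc hinp).lostSup P ptP 𝒜 ℬ, wP s ≤ δP)
    (hinfP : ∀ 𝒜 ℬ, IsApproxW μ c ε 𝒜 → IsApproxW μ c ε ℬ →
      ∑ s ∈ (schemeW μ c ε hμ hc hinp).lostInf P ptP 𝒜 ℬ, wP s ≤ δP)
    (C : Circuit V) (hC : C.IsOver monotoneBasis) :
    ∃ (𝒜 : Finset (Finset V)) (BadP : Finset σ) (BadN : Finset (Finset V)), IsApproxW μ c ε 𝒜 ∧
      ∑ s ∈ BadP, wP s ≤ C.size * δP ∧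
      ∑ U ∈ BadN, μ U ≤ C.size * (ε * #(univ.filter fun A : Finset V => #A ≤ c)) ∧
      (∀ s ∈ P, s ∉ BadP → C.eval (ptP s) = true → finsetEquivFun.symm (ptP s) ∈ 𝒜) ∧
      (∀ U : Finset V, U ∉ BadN → U ∈ 𝒜 → C.eval (finsetEquivFun U) = true) := by
  classical
  haveI : Inhabited (Finset (Finset V)) := ⟨∅⟩
  obtain ⟨𝒜, BadP, BadN, hok, hcP, hcN, hpos, hneg⟩ :=
    (schemeW μ c ε hμ hc hinp).exists_approx_circuit P ptP wP univ finsetEquivFun μ hwP hμ δP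
      (ε * #(univ.filter fun A : Finset V => #A ≤ c)) hsupP hinfP
      (fun a b ha hb => sum_gainedSupW_le hμ hμ1 hc hinp hε0 ha hb)
      (fun a b ha hb => sum_gainedInfW_le hμ hμ1 hc hinp hε0 ha hb) C hC (f := C.eval) (fun _ => rfl)
  refine ⟨𝒜, BadP, BadN, hok, hcP, hcN, fun s hs hsB hCs => ?_, fun U hUB hU𝒜 => ?_⟩
  · have := hpos s hs hsB hCs
    simpa [schemeW] using this
  · have h := hneg U (mem_univ _) hUB
    simp only [schemeW_val_finsetEquivFun, decide_eq_true_eq] at h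
    exact h hU𝒜

end Summit.PneNP.PneNP.Theorems.NegLimitedGapPM
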